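import Literature.Computability.AlgebraicComplexity.BILPS19MinrankVarieties
import HarnessLib

/-!
# BILPS Lemma 17 discharged: tensors of minrank `≤ r` live in `U ⊗ V ⊗ W'` with `dim W' = n(k-1)+r`

Proof file (theorem-only) for `BILPS2019_lemma17` of `BILPS19MinrankVarieties.lean`
(Bläser–Ikenmeyer–Lysikov–Pandey–Schreyer, arXiv:1911.02534, Lemma 17, p0023:L54–68). Printed
proof, formalised: "Let `T ∈ 𝓜_r` and `x_1 ≠ 0` with `rk(Tx_1) ≤ r` … Since `rk A_1 ≤ r`, there exists
a subspace `W_1 ⊂ W` of dimension at most `r` such that `A_1 ∈ V ⊗ W_1`. Analogously, for `i > 1` we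
have `A_i ∈ V ⊗ W_i` for some subspace `W_i ⊂ W` of dimension at most `n`. The sum `W'` of all `W_i` is a
subspace of dimension at most `s`. We extend it to dimension `s` in arbitrary way if needed." Here
`W_1` = the row space of the contraction `Tx` (dimension `rk(Tx) ≤ r`), the `W_i` = the row spaces
of the slices `T_a`, `a ≠ a₀`, for an index `a₀` with `x_{a₀} ≠ 0` (the slice `T_{a₀}` is recovered
from `Tx` and the other slices), and the extension step is `exists_le_finrank_eq_of_le`. Valid over
every field. Honest framing (val-lit): a discharge of a typed literature fact; nothing here bears on
`VP ≠ VNP`.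
-/

noncomputable section

namespace Literature.Computability.AlgebraicComplexity

open Module Submodule

section Extension

variable {F : Type*} [Field F] {V : Type*} [AddCommGroup V] [Module F V] [FiniteDimensional F V]

/-- "We extend it to dimension `s` in arbitrary way if needed": a subspace of dimension `≤ s ≤ dim V`
is contained in a subspace of dimension exactly `s`.
[cite: BlaserIkenmeyerLysikovPandeySchreyer2019, Lemma 17 (proof)] -/
theorem exists_le_finrank_eq_of_le (W₀ : Submodule F V) {s : ℕ} (h₁ : finrank F W₀ ≤ s)
    (h₂ : s ≤ finrank F V) : ∃ W' : Submodule F V, W₀ ≤ W' ∧ finrank F W' = s := by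
  obtain ⟨C, hC⟩ := W₀.exists_isCompl
  have hCdim : finrank F W₀ + finrank F C = finrank F V := by
    have h := Submodule.finrank_sup_add_finrank_inf_eq W₀ C
    rw [hC.sup_eq_top, hC.inf_eq_bot, finrank_bot, finrank_top, add_zero] at h
    exact h.symm
  have hd : s - finrank F W₀ ≤ finrank F C := by omega
  let b := Module.finBasis F C
  let v : Fin (s - finrank F W₀) → C := fun i => b (Fin.castLE hd i)
  have hli : LinearIndependent F v := b.linearIndependent.comp _ (Fin.castLE_injective hd)
  let U : Submodule F V := (span F (Set.range v)).map C.subtype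
  have hUC : U ≤ C := Submodule.map_subtype_le C _
  have hUdim : finrank F U = s - finrank F W₀ := by
    rw [Submodule.finrank_map_subtype_eq, finrank_span_eq_card hli, Fintype.card_fin]
  refine ⟨W₀ ⊔ U, le_sup_left, ?_⟩
  have hinf : W₀ ⊓ U = ⊥ :=
    eq_bot_iff.mpr ((inf_le_inf_left W₀ hUC).trans hC.inf_eq_bot.le)
  have h := Submodule.finrank_sup_add_finrank_inf_eq W₀ U
  rw [hinf, finrank_bot, add_zero, hUdim] at h
  omega

end Extension

section Lemma17

variable {F : Type*} [Field F] {k n w : ℕ}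

/-- The contraction row by row: `(Tx)_b = ∑_a x_a (T_a)_b`.
[cite: BlaserIkenmeyerLysikovPandeySchreyer2019, §5] -/
theorem contract3_row (T : Fin k → Fin n → Fin w → F) (x : Fin k → F) (b : Fin n) :
    contract3 T x b = ∑ a, x a • T a b := by
  funext c
  simp [contract3_apply, Finset.sum_apply]

/-- The dimension of a finite supremum of subspaces is at most the sum of the dimensions.
[cite: BlaserIkenmeyerLysikovPandeySchreyer2019, Lemma 17 (proof)] -/
theorem finrank_finset_sup_le {V : Type*} [AddCommGroup V] [Module F V] [FiniteDimensional F V]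
    {ι : Type*} (S : Finset ι) (f : ι → Submodule F V) :
    finrank F (S.sup f : Submodule F V) ≤ ∑ i ∈ S, finrank F (f i) := by
  classical
  induction S using Finset.induction_on with
  | empty => simp
  | insert a S ha ih =>
    rw [Finset.sup_insert, Finset.sum_insert ha]
    exact (Submodule.finrank_add_le_finrank_add_finrank _ _).trans (by omega)

end Lemma17

/-- **BILPS Lemma 17, discharged.** [cite: BlaserIkenmeyerLysikovPandeySchreyer2019, Lemma 17] -/
theorem BILPS2019_lemma17_holds : BILPS2019_lemma17 := by
  intro F _ _ k n w r hw T hT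
  classical
  obtain ⟨x, hx, hr⟩ := hT
  obtain ⟨a₀, ha₀⟩ : ∃ a, x a ≠ 0 := by
    by_contra h
    push Not at h
    exact hx (funext h)
  -- the row spaces `W_1` (of `Tx`) and `W_a` (of the slices `T_a`, `a ≠ a₀`)
  let W₁ : Submodule F (Fin w → F) := span F (Set.range (contract3 T x))
  let Wa : Fin k → Submodule F (Fin w → F) := fun a => span F (Set.range (T a))
  let W₀ : Submodule F (Fin w → F) := W₁ ⊔ (Finset.univ.erase a₀).sup Wa
  have hW₁ : finrank F W₁ ≤ r := by
    have h := Matrix.rank_eq_finrank_span_row (contract3 T x)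
    change (contract3 T x).rank = finrank F W₁ at h
    omega
  have hWa : ∀ a, finrank F (Wa a) ≤ n := fun a =>
    (finrank_range_le_card (R := F) (T a)).trans (by simp)
  have hW₀ : finrank F W₀ ≤ n * (k - 1) + r := by
    refine (Submodule.finrank_add_le_finrank_add_finrank _ _).trans ?_
    have h2 : finrank F ((Finset.univ.erase a₀).sup Wa : Submodule F (Fin w → F)) ≤ n * (k - 1) :=
      calc finrank F ((Finset.univ.erase a₀).sup Wa : Submodule F (Fin w → F))
          ≤ ∑ a ∈ Finset.univ.erase a₀, finrank F (Wa a) := finrank_finset_sup_le _ _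
        _ ≤ ∑ _a ∈ Finset.univ.erase a₀, n := Finset.sum_le_sum fun a _ => hWa a
        _ = n * (k - 1) := by
            rw [Finset.sum_const, smul_eq_mul, Finset.card_erase_of_mem (Finset.mem_univ a₀),
              Finset.card_univ, Fintype.card_fin, Nat.mul_comm]
    omega
  -- every leg lies in `W₀`
  have hmem : ∀ a b, T a b ∈ W₀ := by
    intro a b
    by_cases ha : a = a₀
    · subst ha
      -- `T_{a₀} b = x_{a₀}⁻¹ • ((Tx)_b - ∑_{a ≠ a₀} x_a (T_a)_b)`
      have hrow := contract3_row T x b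
      rw [← Finset.add_sum_erase _ _ (Finset.mem_univ a)] at hrow
      have hTa : T a b = (x a)⁻¹ • (contract3 T x b - ∑ a' ∈ Finset.univ.erase a, x a' • T a' b) := by
        rw [hrow, add_sub_cancel_right, smul_smul, inv_mul_cancel₀ ha₀, one_smul]
      rw [hTa]
      refine Submodule.smul_mem _ _ (Submodule.sub_mem _ ?_ ?_)
      · exact (le_sup_left : W₁ ≤ W₀) (subset_span ⟨b, rfl⟩)
      · refine Submodule.sum_mem _ fun a' ha' => Submodule.smul_mem _ _ ?_
        exact (le_sup_right : (Finset.univ.erase a).sup Wa ≤ W₀)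
          (Finset.le_sup (f := Wa) ha' (subset_span ⟨b, rfl⟩))
    · have ha' : a ∈ Finset.univ.erase a₀ := Finset.mem_erase.mpr ⟨ha, Finset.mem_univ a⟩
      exact (le_sup_right : (Finset.univ.erase a₀).sup Wa ≤ W₀)
        (Finset.le_sup (f := Wa) ha' (subset_span ⟨b, rfl⟩))
  -- extend to dimension exactly `s`
  obtain ⟨W', hW₀W', hW'⟩ := exists_le_finrank_eq_of_le W₀ hW₀ (by simp; omega)
  exact ⟨W', hW', fun a b => hW₀W' (hmem a b)⟩

end Literature.Computability.AlgebraicComplexity
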